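import Summits.NavierStokesRegularity.NavierStokesRegularity.Theorems.SqueezeCycleRecurrentLiouvilleRotationalAbsorptionFast
import Summits.NavierStokesRegularity.NavierStokesRegularity.Theorems.SqueezeCycleRecurrentLiouvilleSmallHullRemoval
import Summits.NavierStokesRegularity.NavierStokesRegularity.Theorems.SqueezeCycleRecurrentLiouvilleRotationOrbitContinuous
import Literature.Analysis.FluidPDE.AxisymGradientField
import HarnessLib

/-!
# Crux `RecurrentLiouville` (stmt-NavierStokesRegularity-1589), line `Sketch` — slow rotational
  absorption in the Albritton–Barker class
`rotationalAbsorptionSlow` (registered alias `stub_rlRotationalAbsorptionSlow`): ∀ `C`, `M < ⊤`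
∃ `α_ > 0`, `δ > 0`: a class profile (suitable weak solution of Navier–Stokes on `ℝ³ × ℝ₋`, weak
gradient, `𝐈 ≤ M`, rate `‖u(t,x)‖ ≤ C/√(−t)`) whose scaling orbit is `δ`-shadowed in `L³(Q(0,2))` by a
rotation about the `x₃`-axis of angular log-speed `|α| ≤ α_` —
`‖R_{ασ} u_{e^σ} ∘ T_{−ασ} − u‖_{L³(Q(0,2))} ≤ δ` for every log-scale `σ` — is regular at the origin:
the SLOW half of the rotated-self-similar rung (Pineau–Vicol 2026, Thm. 1.4: no singular RSS profile
with `|α| < α_(C)` in the decaying class), transplanted to the crux's class WITHOUT decay and in open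
(shadowed) form; the fast half `|α| ≥ ᾱ` is `rotationalAbsorptionFast`.  Slowly precessing orbits are absorbed into the SELF-SIMILAR rung: if
`α_k, δ_k → 0` fail with singular `u_k`, a subsequence converges in every `L³(Q(0,R))` to an
origin-singular class profile `w` (`stub_rlClassLimit`); at a fixed log-scale `σ` the shadowing
angles `α_k σ → 0`, and the continuity of the ROTATION orbit of `w` in `L³(Q(0,1))`
(`stub_rlRotationOrbitContinuousTools`) gives `w_{e^σ} = w` in `L³(Q(0,1))` for every `σ`
(`rlRotSlow_fixedScale`), hence a.e. on the slab (`stub_rlSelfSimilarOfShrinkingOrbit` on the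
constant sequence); an a.e. self-similar class profile is a.e. a pointwise self-similar Type-I
ancient mild field (`stub_rlSelfSimilarRepr`), which vanishes (Tsai 1998, Thm 1;
`stub_rlSelfSimilarMildVanishes`) — contradicting the singular origin.  Corollaries:
`rssSlow_regular` (exact a.e.-RSS profiles with `|α| ≤ α_(C, M)` are regular) and
`rotationalAbsorption_slow_or_fast` (only a compact window `α_ < |α| < ᾱ` of precession speeds
survives — Pineau–Vicol's open `α ≈ 1` regime, Conj. 1.1 —, now for the Albritton–Barker class).
Refs: [PineauVicol2026] Thm. 1.4, Conj. 1.1; [Tsai1998] Thm. 1; [AlbrittonBarker2019] Lemma 2.2,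
Prop. 2.3, §3; [KNSS2009] Prop. 4.1; [SereginSverak2009] Thm. 3.1 (fast half).
-/

noncomputable section

-- the sub-problem namespace repeats the summit name (D-0017 layout `Summit.<S>.<P>.Theorems`)
set_option linter.dupNamespace false

namespace Summit.NavierStokesRegularity.NavierStokesRegularity.Theorems

open MeasureTheory Set Function Filter Topology TopologicalSpace Metric Literature.Analysis.FluidPDE
open scoped NNReal ENNReal

/-- **The fixed-scale estimate.**  If `u_j → w` in `L³(Q(0,R))` for all `R`, the rotation orbit of
`w` is continuous in `L³(Q(0,1))`, the angles `θ_j → 0`, and at the scale `c > 0` the rescalings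
`(u_j)_c` are `δ_j`-close on `Q(0,2)` to the rotated conjugates `R_{θ_j} (u_j ∘ T_{−θ_j})`, `δ_j → 0`,
then `w_c = w` in `L³(Q(0,1))` (four-term splitting through `(u_j)_c`, `R_{θ_j}(u_j∘T)`,
`R_{θ_j}(w∘T)`; exact scaling law, isometry of the rotated conjugation). [folklore] -/
theorem rlRotSlow_fixedScale {c : ℝ} (hc : 0 < c)
    {uj : ℕ → ℝ → EuclideanSpace ℝ (Fin 3) → EuclideanSpace ℝ (Fin 3)}
    {w : ℝ → EuclideanSpace ℝ (Fin 3) → EuclideanSpace ℝ (Fin 3)} {θ : ℕ → ℝ} {δ' : ℕ → ℝ≥0∞}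
    (hum : ∀ (j : ℕ) (r : ℝ), 0 < r → ∀ R : ℝ, 0 < R → AEStronglyMeasurable (uncurry (nsRescale r (uj j)))
      (volume.restrict (parabolicCylinder R (0 : ℝ × EuclideanSpace ℝ (Fin 3)))))
    (hwm : ∀ (r : ℝ), 0 < r → ∀ R : ℝ, 0 < R → AEStronglyMeasurable (uncurry (nsRescale r w))
      (volume.restrict (parabolicCylinder R (0 : ℝ × EuclideanSpace ℝ (Fin 3)))))
    (hθ : Tendsto θ atTop (𝓝 0))
    (hrot : Tendsto (fun φ : ℝ => eLpNorm (fun z : ℝ × EuclideanSpace ℝ (Fin 3) =>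
        rotZ φ (w z.1 (rotZ (-φ) z.2)) - w z.1 z.2) 3
      (volume.restrict (parabolicCylinder 1 (0 : ℝ × EuclideanSpace ℝ (Fin 3))))) (𝓝 0) (𝓝 0))
    (hconv : ∀ R : ℝ, 0 < R → Tendsto (fun j => eLpNorm (uncurry (uj j) - uncurry w) 3
      (volume.restrict (parabolicCylinder R (0 : ℝ × EuclideanSpace ℝ (Fin 3))))) atTop (𝓝 0))
    (hshadow : ∀ j, eLpNorm (uncurry (nsRescale c (uj j)) -
        fun z : ℝ × EuclideanSpace ℝ (Fin 3) => rotZ (θ j) (uncurry (uj j) (z.1, rotZ (-θ j) z.2))) 3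
        (volume.restrict (parabolicCylinder 2 (0 : ℝ × EuclideanSpace ℝ (Fin 3)))) ≤ δ' j)
    (hδ' : Tendsto δ' atTop (𝓝 0)) :
    eLpNorm (uncurry (nsRescale c w) - uncurry w) 3
      (volume.restrict (parabolicCylinder 1 (0 : ℝ × EuclideanSpace ℝ (Fin 3)))) = 0 := by
  have h13 : (1 : ℝ≥0∞) ≤ 3 := by norm_num
  have hwm1 : ∀ R : ℝ, 0 < R → AEStronglyMeasurable (uncurry w)
      (volume.restrict (parabolicCylinder R (0 : ℝ × EuclideanSpace ℝ (Fin 3)))) := by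
    intro R hR
    have h := hwm 1 one_pos R hR
    rwa [nsRescale_one] at h
  have hum1 : ∀ (j : ℕ) (R : ℝ), 0 < R → AEStronglyMeasurable (uncurry (uj j))
      (volume.restrict (parabolicCylinder R (0 : ℝ × EuclideanSpace ℝ (Fin 3)))) := by
    intro j R hR
    have h := hum j 1 one_pos R hR
    rwa [nsRescale_one] at h
  -- the rotated conjugates on `Q(0,1)`
  have hFjm : ∀ j, AEStronglyMeasurable (fun z : ℝ × EuclideanSpace ℝ (Fin 3) =>
      rotZ (θ j) (uncurry (uj j) (z.1, rotZ (-θ j) z.2)))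
      (volume.restrict (parabolicCylinder 1 (0 : ℝ × EuclideanSpace ℝ (Fin 3)))) := fun j =>
    rlRotAbs_aesm_conj (θ j) 1 (g := uncurry (uj j)) (hum1 j 1 one_pos)
  have hFwm : ∀ j, AEStronglyMeasurable (fun z : ℝ × EuclideanSpace ℝ (Fin 3) =>
      rotZ (θ j) (uncurry w (z.1, rotZ (-θ j) z.2)))
      (volume.restrict (parabolicCylinder 1 (0 : ℝ × EuclideanSpace ℝ (Fin 3)))) := fun j =>
    rlRotAbs_aesm_conj (θ j) 1 (g := uncurry w) (hwm1 1 one_pos)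
  -- the scaling constant
  set K : ℝ≥0∞ := ‖c‖ₑ * (ENNReal.ofReal (c ^ 2 * c ^ 3)⁻¹) ^ (1 / (3 : ℝ≥0∞).toReal) with hK
  have hKtop : K ≠ ⊤ := zoomConst_ne_top c
  have h12 : parabolicCylinder 1 (0 : ℝ × EuclideanSpace ℝ (Fin 3)) ⊆
      parabolicCylinder 2 (0 : ℝ × EuclideanSpace ℝ (Fin 3)) :=
    SuitableCompactness.parabolicCylinder_zero_mono zero_le_one one_le_two
  -- the four-term bound
  have hle : ∀ j, eLpNorm (uncurry (nsRescale c w) - uncurry w) 3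
      (volume.restrict (parabolicCylinder 1 (0 : ℝ × EuclideanSpace ℝ (Fin 3)))) ≤
      K * eLpNorm (uncurry (uj j) - uncurry w) 3
          (volume.restrict (parabolicCylinder (c * 1) (0 : ℝ × EuclideanSpace ℝ (Fin 3)))) +
      (δ' j +
      (eLpNorm (uncurry (uj j) - uncurry w) 3
        (volume.restrict (parabolicCylinder 1 (0 : ℝ × EuclideanSpace ℝ (Fin 3)))) +
      eLpNorm (fun z : ℝ × EuclideanSpace ℝ (Fin 3) => rotZ (θ j) (w z.1 (rotZ (-θ j) z.2)) - w z.1 z.2) 3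
        (volume.restrict (parabolicCylinder 1 (0 : ℝ × EuclideanSpace ℝ (Fin 3)))))) := by
    intro j
    -- Term 1: exact scaling law
    have hT1 : eLpNorm (uncurry (nsRescale c w) - uncurry (nsRescale c (uj j))) 3
        (volume.restrict (parabolicCylinder 1 (0 : ℝ × EuclideanSpace ℝ (Fin 3)))) =
        K * eLpNorm (uncurry (uj j) - uncurry w) 3
          (volume.restrict (parabolicCylinder (c * 1) (0 : ℝ × EuclideanSpace ℝ (Fin 3)))) := by
      rw [nsRescale_eq_zoom, nsRescale_eq_zoom, eLpNorm_zoom_sub_zoom _ _ hc 1, eLpNorm_sub_comm]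
    -- Term 2: the shadowing, restricted to `Q(0,1)`
    have hT2 : eLpNorm (uncurry (nsRescale c (uj j)) -
        fun z : ℝ × EuclideanSpace ℝ (Fin 3) => rotZ (θ j) (uncurry (uj j) (z.1, rotZ (-θ j) z.2))) 3
        (volume.restrict (parabolicCylinder 1 (0 : ℝ × EuclideanSpace ℝ (Fin 3)))) ≤ δ' j :=
      (eLpNorm_mono_measure _ (Measure.restrict_mono h12 le_rfl)).trans (hshadow j)
    -- Term 3: the rotated conjugation is an isometry
    have hT3 : eLpNorm ((fun z : ℝ × EuclideanSpace ℝ (Fin 3) => rotZ (θ j) (uncurry (uj j) (z.1, rotZ (-θ j) z.2))) -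
        fun z : ℝ × EuclideanSpace ℝ (Fin 3) => rotZ (θ j) (uncurry w (z.1, rotZ (-θ j) z.2))) 3
        (volume.restrict (parabolicCylinder 1 (0 : ℝ × EuclideanSpace ℝ (Fin 3)))) =
        eLpNorm (uncurry (uj j) - uncurry w) 3
          (volume.restrict (parabolicCylinder 1 (0 : ℝ × EuclideanSpace ℝ (Fin 3)))) :=
      rlRotAbs_eLpNorm_conj (θ j) 1 (hum1 j 1 one_pos) (hwm1 1 one_pos)
    -- Term 4 is the rotation-orbit displacement of `w` (definitionally)
    have hT4 : eLpNorm ((fun z : ℝ × EuclideanSpace ℝ (Fin 3) => rotZ (θ j) (uncurry w (z.1, rotZ (-θ j) z.2))) -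
        uncurry w) 3 (volume.restrict (parabolicCylinder 1 (0 : ℝ × EuclideanSpace ℝ (Fin 3)))) =
        eLpNorm (fun z : ℝ × EuclideanSpace ℝ (Fin 3) => rotZ (θ j) (w z.1 (rotZ (-θ j) z.2)) - w z.1 z.2) 3
          (volume.restrict (parabolicCylinder 1 (0 : ℝ × EuclideanSpace ℝ (Fin 3)))) := rfl
    have e : uncurry (nsRescale c w) - uncurry w =
        (uncurry (nsRescale c w) - uncurry (nsRescale c (uj j))) +
        ((uncurry (nsRescale c (uj j)) -
          fun z : ℝ × EuclideanSpace ℝ (Fin 3) => rotZ (θ j) (uncurry (uj j) (z.1, rotZ (-θ j) z.2))) +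
        (((fun z : ℝ × EuclideanSpace ℝ (Fin 3) => rotZ (θ j) (uncurry (uj j) (z.1, rotZ (-θ j) z.2))) -
            fun z : ℝ × EuclideanSpace ℝ (Fin 3) => rotZ (θ j) (uncurry w (z.1, rotZ (-θ j) z.2))) +
          ((fun z : ℝ × EuclideanSpace ℝ (Fin 3) => rotZ (θ j) (uncurry w (z.1, rotZ (-θ j) z.2))) -
            uncurry w))) := by
      simp only [sub_add_sub_cancel]
    calc eLpNorm (uncurry (nsRescale c w) - uncurry w) 3
          (volume.restrict (parabolicCylinder 1 (0 : ℝ × EuclideanSpace ℝ (Fin 3))))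
        ≤ eLpNorm (uncurry (nsRescale c w) - uncurry (nsRescale c (uj j))) 3
            (volume.restrict (parabolicCylinder 1 (0 : ℝ × EuclideanSpace ℝ (Fin 3)))) +
          (eLpNorm (uncurry (nsRescale c (uj j)) -
              fun z : ℝ × EuclideanSpace ℝ (Fin 3) => rotZ (θ j) (uncurry (uj j) (z.1, rotZ (-θ j) z.2))) 3
            (volume.restrict (parabolicCylinder 1 (0 : ℝ × EuclideanSpace ℝ (Fin 3)))) +
          (eLpNorm ((fun z : ℝ × EuclideanSpace ℝ (Fin 3) => rotZ (θ j) (uncurry (uj j) (z.1, rotZ (-θ j) z.2))) -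
              fun z : ℝ × EuclideanSpace ℝ (Fin 3) => rotZ (θ j) (uncurry w (z.1, rotZ (-θ j) z.2))) 3
            (volume.restrict (parabolicCylinder 1 (0 : ℝ × EuclideanSpace ℝ (Fin 3)))) +
          eLpNorm ((fun z : ℝ × EuclideanSpace ℝ (Fin 3) => rotZ (θ j) (uncurry w (z.1, rotZ (-θ j) z.2))) -
              uncurry w) 3 (volume.restrict (parabolicCylinder 1 (0 : ℝ × EuclideanSpace ℝ (Fin 3)))))) := by
          rw [e]
          refine (eLpNorm_add_le ((hwm c hc 1 one_pos).sub (hum j c hc 1 one_pos))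
            (((hum j c hc 1 one_pos).sub (hFjm j)).add (((hFjm j).sub (hFwm j)).add
              ((hFwm j).sub (hwm1 1 one_pos)))) h13).trans (add_le_add le_rfl ?_)
          refine (eLpNorm_add_le ((hum j c hc 1 one_pos).sub (hFjm j)) (((hFjm j).sub (hFwm j)).add
              ((hFwm j).sub (hwm1 1 one_pos))) h13).trans (add_le_add le_rfl ?_)
          exact eLpNorm_add_le ((hFjm j).sub (hFwm j)) ((hFwm j).sub (hwm1 1 one_pos)) h13
      _ ≤ _ := by
          rw [hT1, hT3, hT4]
          exact add_le_add le_rfl (add_le_add hT2 le_rfl)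
  -- every term tends to zero
  have hA : Tendsto (fun j => K * eLpNorm (uncurry (uj j) - uncurry w) 3
      (volume.restrict (parabolicCylinder (c * 1) (0 : ℝ × EuclideanSpace ℝ (Fin 3))))) atTop (𝓝 0) := by
    have h := ENNReal.Tendsto.const_mul (hconv (c * 1) (by positivity)) (Or.inr hKtop) (a := K)
    rwa [mul_zero] at h
  have hD : Tendsto (fun j => eLpNorm (fun z : ℝ × EuclideanSpace ℝ (Fin 3) =>
      rotZ (θ j) (w z.1 (rotZ (-θ j) z.2)) - w z.1 z.2) 3
      (volume.restrict (parabolicCylinder 1 (0 : ℝ × EuclideanSpace ℝ (Fin 3))))) atTop (𝓝 0) :=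
    hrot.comp hθ
  have hlim := hA.add (hδ'.add ((hconv 1 one_pos).add hD))
  rw [add_zero, add_zero, add_zero] at hlim
  exact le_antisymm (ge_of_tendsto' hlim hle) zero_le

/-- **Branch C, slow branch — rotational absorption into the self-similar rung.**  For every rate
constant `C` and bound `M < ⊤` there are `α_ > 0` and `δ > 0` such that a suitable weak solution
`(u, p)` of Navier–Stokes (`ν = 1`, `f = 0`) on `ℝ³ × ℝ₋` with weak gradient `G`, `𝐈(ℝ³ × ℝ₋) ≤ M`
and the Type-I rate `‖u(t,x)‖ ≤ C/√(−t)`, whose scaling orbit is `δ`-SHADOWED on `Q(0,2)` by a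
one-parameter rotation about the `x₃`-axis of angular log-speed `α` with `|α| ≤ α_` —
`‖R_{ασ} u_{e^σ} ∘ T_{−ασ} − u‖_{L³(Q(0,2))} ≤ δ` for every log-scale `σ` — is regular at the
space–time origin (`δ = 0`: slowly precessing rotated self-similarity; `α = 0`: small-hull
removal).  The slow half of Pineau–Vicol's Theorem 1.4, in the Albritton–Barker class and without
decay; proof by contradiction through `stub_rlClassLimit`, `rlRotSlow_fixedScale` (angles
`α_k σ → 0`, rotation-orbit continuity of the limit), `stub_rlSelfSimilarOfShrinkingOrbit`,
`stub_rlSelfSimilarRepr` and `stub_rlSelfSimilarMildVanishes` (Tsai).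
[cite: PineauVicol2026, Thm. 1.4] [cite: Tsai1998, Thm 1] [cite: AlbrittonBarker2019, Lemma 2.2, Prop. 2.3] -/
theorem rotationalAbsorptionSlow :
    ∀ (C : ℝ) (M : ℝ≥0∞), M < ⊤ → ∃ αlow δ : ℝ, 0 < αlow ∧ 0 < δ ∧
      ∀ (α : ℝ), |α| ≤ αlow →
        ∀ (u : ℝ → EuclideanSpace ℝ (Fin 3) → EuclideanSpace ℝ (Fin 3))
          (p : ℝ → EuclideanSpace ℝ (Fin 3) → ℝ)
          (G : ℝ → EuclideanSpace ℝ (Fin 3) → EuclideanSpace ℝ (Fin 3) →L[ℝ] EuclideanSpace ℝ (Fin 3)),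
          IsSuitableWeakSolutionOn (slab (EuclideanSpace ℝ (Fin 3)) (Iio 0) isOpen_Iio) 1 0 u p →
          HasWeakSpatialGradientOn (slab (EuclideanSpace ℝ (Fin 3)) (Iio 0) isOpen_Iio) u G →
          typeIBound (Iio (0 : ℝ) ×ˢ univ) u p G ≤ M →
          HasTypeITimeDecay C u →
          (∀ σ : ℝ, eLpNorm (fun z : ℝ × EuclideanSpace ℝ (Fin 3) =>
              rotZ (α * σ) (nsRescale (Real.exp σ) u z.1 (rotZ (-(α * σ)) z.2)) - u z.1 z.2) 3
              (volume.restrict (parabolicCylinder 2 (0 : ℝ × EuclideanSpace ℝ (Fin 3)))) ≤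
            ENNReal.ofReal δ) →
          ¬ IsBackwardSingularPoint u 0 := by
  intro C M hM
  by_contra hcon
  push Not at hcon
  have hδk : ∀ k : ℕ, (0 : ℝ) < 1 / ((k : ℝ) + 1) := fun k => by positivity
  choose α hα u p G hsw hwg hI hdec hshadow hsing using fun k : ℕ => hcon _ _ (hδk k) (hδk k)
  -- a singular class limit with the rate
  obtain ⟨w, q, H, ψ, hψ, hsw', hwg', hI', hdec', hsing', hconv⟩ :=
    stub_rlClassLimit C M hM u p G hsw hwg hI hdec hsing
  -- measurability of (rescaled) class profiles on the balls
  have hmeas : ∀ (k : ℕ) (c : ℝ), 0 < c → ∀ R : ℝ, 0 < R →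
      AEStronglyMeasurable (uncurry (nsRescale c (u k)))
        (volume.restrict (parabolicCylinder R (0 : ℝ × EuclideanSpace ℝ (Fin 3)))) := by
    intro k c hc R _
    rw [nsRescale_eq_zoom]
    exact (zoom_slabProfile (hsw k) (hwg k) hc).2.1.locallyIntegrableOn.aestronglyMeasurable.mono_measure
      (Measure.restrict_mono (parabolicCylinder_origin_subset_slab _) le_rfl)
  have hmeasw : ∀ (c : ℝ), 0 < c → ∀ R : ℝ, 0 < R →
      AEStronglyMeasurable (uncurry (nsRescale c w))
        (volume.restrict (parabolicCylinder R (0 : ℝ × EuclideanSpace ℝ (Fin 3)))) := by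
    intro c hc R _
    rw [nsRescale_eq_zoom]
    exact (zoom_slabProfile hsw' hwg' hc).2.1.locallyIntegrableOn.aestronglyMeasurable.mono_measure
      (Measure.restrict_mono (parabolicCylinder_origin_subset_slab _) le_rfl)
  -- the rotation orbit of `w` is continuous in `L³(Q(0,1))`
  have hrot := stub_rlRotationOrbitContinuousTools w
    (fun R hR => memLp_three_of_slabProfile hwg' hI' hR) 1 one_pos
  have hψ0 : Tendsto (fun j : ℕ => 1 / (((ψ j : ℕ) : ℝ) + 1)) atTop (𝓝 0) :=
    (tendsto_one_div_add_atTop_nhds_zero_nat (𝕜 := ℝ)).comp hψ.tendsto_atTop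
  -- KEY: `w_{e^σ} = w` in `L³(Q(0,1))` for every log-scale `σ`
  have h1 : ∀ σ : ℝ, eLpNorm (uncurry (nsRescale (Real.exp σ) w) - uncurry w) 3
      (volume.restrict (parabolicCylinder 1 (0 : ℝ × EuclideanSpace ℝ (Fin 3)))) = 0 := by
    intro σ
    -- the angles `θ_j = -(α_{ψ j} σ) → 0`
    set θ : ℕ → ℝ := fun j => -(α (ψ j) * σ) with hθdef
    have hθ0 : Tendsto θ atTop (𝓝 0) := by
      have hb : Tendsto (fun j : ℕ => 1 / (((ψ j : ℕ) : ℝ) + 1) * |σ|) atTop (𝓝 0) := by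
        have h := hψ0.mul_const |σ|
        rwa [zero_mul] at h
      refine squeeze_zero_norm (fun j => ?_) hb
      rw [hθdef]
      dsimp only
      rw [norm_neg, norm_mul, Real.norm_eq_abs, Real.norm_eq_abs]
      exact mul_le_mul_of_nonneg_right (hα (ψ j)) (abs_nonneg σ)
    -- the shadowing at `σ`, conjugated back by `θ_j`
    have hshadowj : ∀ j, eLpNorm (uncurry (nsRescale (Real.exp σ) (u (ψ j))) -
        fun z : ℝ × EuclideanSpace ℝ (Fin 3) => rotZ (θ j) (uncurry (u (ψ j)) (z.1, rotZ (-θ j) z.2))) 3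
        (volume.restrict (parabolicCylinder 2 (0 : ℝ × EuclideanSpace ℝ (Fin 3)))) ≤
        ENNReal.ofReal (1 / (((ψ j : ℕ) : ℝ) + 1)) := by
      intro j
      have h := hshadow (ψ j) σ
      have ha : α (ψ j) * σ = -θ j := by rw [hθdef]; dsimp only; rw [neg_neg]
      rw [ha] at h
      simp only [neg_neg] at h
      -- `h : ‖R_{-θ} ((u_j)_c ∘ T_{θ}) − u_j‖ ≤ δ_j`; conjugate by `θ`
      have hfm : AEStronglyMeasurable (fun z : ℝ × EuclideanSpace ℝ (Fin 3) =>
          rotZ (-θ j) (uncurry (nsRescale (Real.exp σ) (u (ψ j))) (z.1, rotZ (θ j) z.2)))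
          (volume.restrict (parabolicCylinder 2 (0 : ℝ × EuclideanSpace ℝ (Fin 3)))) := by
        have h' := rlRotAbs_aesm_conj (-θ j) 2 (g := uncurry (nsRescale (Real.exp σ) (u (ψ j))))
          (hmeas (ψ j) _ (Real.exp_pos σ) 2 two_pos)
        simpa only [neg_neg] using h'
      have hgm : AEStronglyMeasurable (uncurry (u (ψ j)))
          (volume.restrict (parabolicCylinder 2 (0 : ℝ × EuclideanSpace ℝ (Fin 3)))) := by
        have h' := hmeas (ψ j) 1 one_pos 2 two_pos
        rwa [nsRescale_one] at h'
      have hconj := rlRotAbs_eLpNorm_conj (θ j) 2 hfm hgm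
      have e : (fun z : ℝ × EuclideanSpace ℝ (Fin 3) =>
          rotZ (θ j) ((fun z : ℝ × EuclideanSpace ℝ (Fin 3) =>
            rotZ (-θ j) (uncurry (nsRescale (Real.exp σ) (u (ψ j))) (z.1, rotZ (θ j) z.2))) (z.1, rotZ (-θ j) z.2)) -
          rotZ (θ j) (uncurry (u (ψ j)) (z.1, rotZ (-θ j) z.2))) =
          uncurry (nsRescale (Real.exp σ) (u (ψ j))) -
            fun z : ℝ × EuclideanSpace ℝ (Fin 3) => rotZ (θ j) (uncurry (u (ψ j)) (z.1, rotZ (-θ j) z.2)) := by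
        funext z
        simp only [Pi.sub_apply, rotZ_apply_rotZ_neg, Function.uncurry_apply_pair]
        rfl
      rw [e] at hconj
      rw [hconj]
      exact h
    exact rlRotSlow_fixedScale (Real.exp_pos σ) (uj := fun j => u (ψ j)) (fun j => hmeas (ψ j)) hmeasw hθ0
      hrot hconv hshadowj (by
        have h := ENNReal.tendsto_ofReal hψ0
        rw [ENNReal.ofReal_zero] at h
        exact h)
  -- hence `w` is a.e. self-similar on the slab (the constant sequence has a shrinking orbit)
  have hwm1 : ∀ R : ℝ, 0 < R → AEStronglyMeasurable (uncurry w)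
      (volume.restrict (parabolicCylinder R (0 : ℝ × EuclideanSpace ℝ (Fin 3)))) := by
    intro R hR
    have h := hmeasw 1 one_pos R hR
    rwa [nsRescale_one] at h
  have hss : ∀ σ : ℝ, ∀ᵐ z ∂(volume.restrict (Iio (0 : ℝ) ×ˢ (univ : Set (EuclideanSpace ℝ (Fin 3))))),
      nsRescale (Real.exp σ) w z.1 z.2 = w z.1 z.2 :=
    stub_rlSelfSimilarOfShrinkingOrbit (fun _ => w) w (fun _ => 0) tendsto_const_nhds
      (fun _ => hmeasw) hmeasw
      (fun R hR => by
        simp only [sub_self, eLpNorm_zero]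
        exact tendsto_const_nhds)
      (fun _ σ => by rw [h1 σ]; exact zero_le)
  -- continuous, pointwise scale-invariant Type-I ancient mild representative; it vanishes (Tsai)
  obtain ⟨v, hv, hvss, hae⟩ := stub_rlSelfSimilarRepr C w q H hsw' hwg' hI' hdec' hss
  have hv0 : ∀ t : ℝ, t < 0 → ∀ x, v t x = 0 := stub_rlSelfSimilarMildVanishes C v hv hvss
  -- hence `w = 0` a.e. on `Q(0,1)`: not singular
  have hw0 : ∀ᵐ z ∂(volume.restrict (Iio (0 : ℝ) ×ˢ (univ : Set (EuclideanSpace ℝ (Fin 3))))),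
      uncurry w z = (0 : ℝ × EuclideanSpace ℝ (Fin 3) → EuclideanSpace ℝ (Fin 3)) z := by
    filter_upwards [hae, ae_restrict_mem (measurableSet_Iio.prod MeasurableSet.univ)] with z hz hzm
    rw [hz, Pi.zero_apply]
    exact hv0 z.1 hzm.1 z.2
  have hQ : ∀ᵐ z ∂(volume.restrict (parabolicCylinder 1 (0 : ℝ × EuclideanSpace ℝ (Fin 3)))),
      uncurry w z = (0 : ℝ × EuclideanSpace ℝ (Fin 3) → EuclideanSpace ℝ (Fin 3)) z :=
    ae_restrict_of_ae_restrict_of_subset (parabolicCylinder_origin_subset_slab 1) hw0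
  have h0 : eLpNorm (uncurry w) ∞
      (volume.restrict (parabolicCylinder 1 (0 : ℝ × EuclideanSpace ℝ (Fin 3)))) = 0 := by
    rw [eLpNorm_congr_ae hQ, eLpNorm_zero]
  have htop := hsing' 1 one_pos
  rw [h0] at htop
  exact ENNReal.zero_ne_top htop

/-- **Exact slow RSS profiles are regular** (`δ = 0`): for every `C`, `M < ⊤` there is `α_ > 0`
such that a class profile (`𝐈 ≤ M`, rate `C`) which is a.e. rotated-self-similar with precession
speed `|α| ≤ α_` — `R_{ασ} u_{e^σ}(t, R_{−ασ} x) = u(t, x)` a.e. on the slab, every `σ` — is regular at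
the origin (slow half of Pineau–Vicol 2026 Thm. 1.4 in the Albritton–Barker class, no decay;
`α = 0`: Tsai 1998). [cite: PineauVicol2026, Thm. 1.4] [cite: Tsai1998, Thm 1] -/
theorem rssSlow_regular :
    ∀ (C : ℝ) (M : ℝ≥0∞), M < ⊤ → ∃ αlow : ℝ, 0 < αlow ∧
      ∀ (α : ℝ), |α| ≤ αlow →
        ∀ (u : ℝ → EuclideanSpace ℝ (Fin 3) → EuclideanSpace ℝ (Fin 3))
          (p : ℝ → EuclideanSpace ℝ (Fin 3) → ℝ)
          (G : ℝ → EuclideanSpace ℝ (Fin 3) → EuclideanSpace ℝ (Fin 3) →L[ℝ] EuclideanSpace ℝ (Fin 3)),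
          IsSuitableWeakSolutionOn (slab (EuclideanSpace ℝ (Fin 3)) (Iio 0) isOpen_Iio) 1 0 u p →
          HasWeakSpatialGradientOn (slab (EuclideanSpace ℝ (Fin 3)) (Iio 0) isOpen_Iio) u G →
          typeIBound (Iio (0 : ℝ) ×ˢ univ) u p G ≤ M →
          HasTypeITimeDecay C u →
          (∀ σ : ℝ, ∀ᵐ z ∂(volume.restrict (Iio (0 : ℝ) ×ˢ (univ : Set (EuclideanSpace ℝ (Fin 3))))),
              rotZ (α * σ) (nsRescale (Real.exp σ) u z.1 (rotZ (-(α * σ)) z.2)) = u z.1 z.2) →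
          ¬ IsBackwardSingularPoint u 0 := by
  intro C M hM
  obtain ⟨αlow, δ, hα, hδ, h⟩ := rotationalAbsorptionSlow C M hM
  refine ⟨αlow, hα, fun α hαle u p G hsw hwg hI hdec hrss => h α hαle u p G hsw hwg hI hdec fun σ => ?_⟩
  have hQ : ∀ᵐ z ∂(volume.restrict (parabolicCylinder 2 (0 : ℝ × EuclideanSpace ℝ (Fin 3)))),
      rotZ (α * σ) (nsRescale (Real.exp σ) u z.1 (rotZ (-(α * σ)) z.2)) - u z.1 z.2 =
        (0 : ℝ × EuclideanSpace ℝ (Fin 3) → EuclideanSpace ℝ (Fin 3)) z := by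
    filter_upwards [ae_restrict_of_ae_restrict_of_subset (parabolicCylinder_origin_subset_slab 2) (hrss σ)]
      with z hz
    rw [hz, sub_self, Pi.zero_apply]
  rw [eLpNorm_congr_ae hQ, eLpNorm_zero]
  exact zero_le

/-- **Rotation-shadowed orbits are regular outside a compact window of precession speeds**
(`rotationalAbsorptionSlow` + `rotationalAbsorptionFast`): ∀ `C`, `M < ⊤` ∃ `0 < α_`, `ᾱ`, `δ > 0`:
a class profile whose scaling orbit is `δ`-shadowed on `Q(0,2)` by a rotation of log-speed `α` with
`|α| ≤ α_` OR `ᾱ ≤ |α|` is regular at the origin; a counterexample with a rotation-shadowed hull must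
precess at an intermediate speed (Pineau–Vicol's open middle regime, Conj. 1.1).
[cite: PineauVicol2026, Thm. 1.4 and Conj. 1.1] [cite: SereginSverak2009, Thm. 3.1] [cite: Tsai1998, Thm 1] -/
theorem rotationalAbsorption_slow_or_fast :
    ∀ (C : ℝ) (M : ℝ≥0∞), M < ⊤ → ∃ αlow αbar δ : ℝ, 0 < αlow ∧ 0 < δ ∧
      ∀ (α : ℝ), (|α| ≤ αlow ∨ αbar ≤ |α|) →
        ∀ (u : ℝ → EuclideanSpace ℝ (Fin 3) → EuclideanSpace ℝ (Fin 3))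
          (p : ℝ → EuclideanSpace ℝ (Fin 3) → ℝ)
          (G : ℝ → EuclideanSpace ℝ (Fin 3) → EuclideanSpace ℝ (Fin 3) →L[ℝ] EuclideanSpace ℝ (Fin 3)),
          IsSuitableWeakSolutionOn (slab (EuclideanSpace ℝ (Fin 3)) (Iio 0) isOpen_Iio) 1 0 u p →
          HasWeakSpatialGradientOn (slab (EuclideanSpace ℝ (Fin 3)) (Iio 0) isOpen_Iio) u G →
          typeIBound (Iio (0 : ℝ) ×ˢ univ) u p G ≤ M →
          HasTypeITimeDecay C u →
          (∀ σ : ℝ, eLpNorm (fun z : ℝ × EuclideanSpace ℝ (Fin 3) =>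
              rotZ (α * σ) (nsRescale (Real.exp σ) u z.1 (rotZ (-(α * σ)) z.2)) - u z.1 z.2) 3
              (volume.restrict (parabolicCylinder 2 (0 : ℝ × EuclideanSpace ℝ (Fin 3)))) ≤
            ENNReal.ofReal δ) →
          ¬ IsBackwardSingularPoint u 0 := by
  intro C M hM
  obtain ⟨αlow, δ₁, hα, hδ₁, hslow⟩ := rotationalAbsorptionSlow C M hM
  obtain ⟨αbar, δ₂, hδ₂, hfast⟩ := rotationalAbsorptionFast C M hM
  refine ⟨αlow, αbar, min δ₁ δ₂, hα, lt_min hδ₁ hδ₂, fun α hαc u p G hsw hwg hI hdec hsh => ?_⟩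
  rcases hαc with h | h
  · exact hslow α h u p G hsw hwg hI hdec fun σ =>
      (hsh σ).trans (ENNReal.ofReal_le_ofReal (min_le_left _ _))
  · exact hfast α h u p G hsw hwg hI hdec fun σ =>
      (hsh σ).trans (ENNReal.ofReal_le_ofReal (min_le_right _ _))

/-- **Registered alias** (stub `stub_rlRotationalAbsorptionSlow` of crux stmt-NavierStokesRegularity-1589,
line Sketch, lead c4), verbatim `rotationalAbsorptionSlow`. [cite: PineauVicol2026, Thm. 1.4]
[cite: Tsai1998, Thm 1] -/
theorem stub_rlRotationalAbsorptionSlow :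
    ∀ (C : ℝ) (M : ℝ≥0∞), M < ⊤ → ∃ αlow δ : ℝ, 0 < αlow ∧ 0 < δ ∧
      ∀ (α : ℝ), |α| ≤ αlow →
        ∀ (u : ℝ → EuclideanSpace ℝ (Fin 3) → EuclideanSpace ℝ (Fin 3))
          (p : ℝ → EuclideanSpace ℝ (Fin 3) → ℝ)
          (G : ℝ → EuclideanSpace ℝ (Fin 3) → EuclideanSpace ℝ (Fin 3) →L[ℝ] EuclideanSpace ℝ (Fin 3)),
          IsSuitableWeakSolutionOn (slab (EuclideanSpace ℝ (Fin 3)) (Iio 0) isOpen_Iio) 1 0 u p →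
          HasWeakSpatialGradientOn (slab (EuclideanSpace ℝ (Fin 3)) (Iio 0) isOpen_Iio) u G →
          typeIBound (Iio (0 : ℝ) ×ˢ univ) u p G ≤ M →
          HasTypeITimeDecay C u →
          (∀ σ : ℝ, eLpNorm (fun z : ℝ × EuclideanSpace ℝ (Fin 3) =>
              rotZ (α * σ) (nsRescale (Real.exp σ) u z.1 (rotZ (-(α * σ)) z.2)) - u z.1 z.2) 3
              (volume.restrict (parabolicCylinder 2 (0 : ℝ × EuclideanSpace ℝ (Fin 3)))) ≤
            ENNReal.ofReal δ) →
          ¬ IsBackwardSingularPoint u 0 :=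
  fun C M hM => rotationalAbsorptionSlow C M hM

end Summit.NavierStokesRegularity.NavierStokesRegularity.Theorems

end
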